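import Summits.ResolutionOfSingularities.ResolutionOfSingularities.Theorems.WildConesCampaignW46HypersurfacesCharTwoEmbDimStatement
import Summits.ResolutionOfSingularities.ResolutionOfSingularities.Theorems.WildConesCampaignW46HypersurfacesCharTwoIsolTransfer
import Summits.ResolutionOfSingularities.ResolutionOfSingularities.Theorems.WildConesCampaignW46HypersurfacesCharTwoEmbDimMonotone
import Summits.ResolutionOfSingularities.ResolutionOfSingularities.Theorems.WildConesCampaignW46HypersurfacesCharTwoDFour
import Summits.ResolutionOfSingularities.ResolutionOfSingularities.Theorems.WildConesCampaignW46HypersurfacesCharTwoSidewaysExit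

/-!
# [OURS · L1 W4.6, rung (ii) at p = 2, every dimension] The rev-3 predicates — THE CASE `e = 2` — PROVED
# at `p = 2`, BY NAME, for every `n`

Cell res-hironaka (LADDER-RESOLUTION rung L, D-0089), slot W4.6, seat res-L1-s46-pv-4 (gen 4). Host: route
`WildCones`, crux `ClassicalRegimes` (stmt-ResolutionOfSingularities-16884; proved), `--supports … --as helper`.

HONEST FRAMING. OURS throughout: the six predicates appended in rev 3 of
`Theorems/WildConesCampaignW46HypersurfacesCharTwoEmbDimStatement.lean` are closed here at `p = 2` for every
dimension `n` by one-line applications of `…HypersurfacesCharTwo{Hilbert,TangentCone,IsolTransfer,EmbDimMonotone}.lean`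
(p512443, p513980, and the IsolTransfer / EmbDimMonotone files). Nothing here is a statement of the manuscript [Hironaka2017]; no FACT-LIST
premise; every field of characteristic `2`. AI review is weaker than expert review.

* `campaignW46HypersurfacesEmbDimTwoHilbertRange_two n`  — `CampaignW46HypersurfacesEmbDimTwoHilbertRange 2 n`
* `campaignW46HypersurfacesEmbDimTwoNoTangent_two n`     — `CampaignW46HypersurfacesEmbDimTwoNoTangent 2 n`
* `campaignW46HypersurfacesEmbDimTwoThreeTangents_two n` — `CampaignW46HypersurfacesEmbDimTwoThreeTangents 2 n`
* `campaignW46HypersurfacesEmbDimTwoIsolated_two n`      — `CampaignW46HypersurfacesEmbDimTwoIsolated 2 n`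
* `campaignW46HypersurfacesIsolStepCriterion_two n`      — `CampaignW46HypersurfacesIsolStepCriterion 2 n`
* `campaignW46HypersurfacesEmbDimMonotone_two n`        — `CampaignW46HypersurfacesEmbDimMonotone 2 n`

REV 2 (APPEND-ONLY; the six rev-1 closers byte-identical; one import added): + `campaignW46HypersurfacesEmbDimTwoDFour_two n`,
`campaignW46HypersurfacesEmbDimTwoDropThree_two n` — the two rev-4 predicates of the statement file closed at `p = 2` by
`…HypersurfacesCharTwoDFour.lean`.

REV 3 (APPEND-ONLY; one import, one closer added): + `campaignW46HypersurfacesEmbDimTwoExit_two n` (rev-5 predicate,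
`…SidewaysExit.lean`, p518449).

References: the statement file (rev 3 / rev 4 / rev 5); G.-M. Greuel, G. Pfister, J. Algebra 689 (2026) [GreuelPfister2026]; H.
Hironaka, ms. 2017 [Hironaka2017] Th. 16.6 p.84 / Th. 16.13 p.87 — role replaced only, under adjudication.
-/

noncomputable section

-- single-problem summit: the doubled namespace component `ResolutionOfSingularities` is forced
set_option linter.dupNamespace false

namespace Summit.ResolutionOfSingularities.ResolutionOfSingularities.Theorems

open CampaignW46 CampaignW46.HypersurfacesCharTwo

/-- [OURS · L1 W4.6 rung (ii), every `n`; NOT a statement of the manuscript]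
`CampaignW46HypersurfacesEmbDimTwoHilbertRange 2 n` holds (`milnorHilbertTwo_range`).
[cite: GreuelPfister2026, Thm 3.5 and Cor 3.7] -/
theorem campaignW46HypersurfacesEmbDimTwoHilbertRange_two (n : ℕ) :
    CampaignW46HypersurfacesEmbDimTwoHilbertRange 2 n :=
  fun _ _ _ _ hM he => ⟨(milnorHilbertTwo_range hM he).1, (milnorHilbertTwo_range hM he).2.1⟩

/-- [OURS · L1 W4.6 rung (ii), every `n`; NOT a statement of the manuscript]
`CampaignW46HypersurfacesEmbDimTwoNoTangent 2 n` holds (`hypersurface_not_isol_step_of_milnorHilbertTwo_eq_three`).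
[folklore] -/
theorem campaignW46HypersurfacesEmbDimTwoNoTangent_two (n : ℕ) :
    CampaignW46HypersurfacesEmbDimTwoNoTangent 2 n :=
  fun _ _ _ c i τ hM he hh hM' => hypersurface_not_isol_step_of_milnorHilbertTwo_eq_three c i τ hM he hh hM'

/-- [OURS · L1 W4.6 rung (ii), every `n`; NOT a statement of the manuscript]
`CampaignW46HypersurfacesEmbDimTwoThreeTangents 2 n` holds (`hypersurface_regime_step_of_milnorHilbertTwo_eq_one`,
`hypersurface_not_multP_step_step_of_milnorHilbertTwo_eq_one`). [folklore] -/
theorem campaignW46HypersurfacesEmbDimTwoThreeTangents_two (n : ℕ) :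
    CampaignW46HypersurfacesEmbDimTwoThreeTangents 2 n :=
  fun _ _ _ c i τ hM he hh hM' =>
    have h := hypersurface_regime_step_of_milnorHilbertTwo_eq_one c i τ hM he hh hM'
    ⟨h.1, h.2.1, h.2.2, hypersurface_not_multP_step_step_of_milnorHilbertTwo_eq_one c i τ hM he hh hM'⟩

/-- [OURS · L1 W4.6 rung (ii), every `n`; NOT a statement of the manuscript]
`CampaignW46HypersurfacesEmbDimTwoIsolated 2 n` holds (`hypersurface_isol_step_of_milnorHilbertTwo_le_two`).
[cite: GreuelPfister2026, Thm 3.5 and Cor 3.7] -/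
theorem campaignW46HypersurfacesEmbDimTwoIsolated_two (n : ℕ) :
    CampaignW46HypersurfacesEmbDimTwoIsolated 2 n :=
  fun _ _ _ c i τ hM hI he hh hM' => hypersurface_isol_step_of_milnorHilbertTwo_le_two c i τ hM hI he hh hM'

/-- [OURS · L1 W4.6 rung (ii), every `n`; NOT a statement of the manuscript]
`CampaignW46HypersurfacesIsolStepCriterion 2 n` holds (`hypersurface_isol_step_iff`): THE COMPLETE ONE-STEP
CRITERION at `p = 2`. [cite: GreuelPfister2026, Thm 3.5 and Cor 3.7] -/
theorem campaignW46HypersurfacesIsolStepCriterion_two (n : ℕ) :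
    CampaignW46HypersurfacesIsolStepCriterion 2 n :=
  fun _ _ _ c i τ hM hI hM' => hypersurface_isol_step_iff c i τ hM hI hM'

/-- [OURS · L1 W4.6 rung (ii), every `n`; NOT a statement of the manuscript]
`CampaignW46HypersurfacesEmbDimMonotone 2 n` holds (`hypersurface_milnorEmbDim_step_le`).
[cite: GreuelPfister2026, Thm 3.5 and Cor 3.7] -/
theorem campaignW46HypersurfacesEmbDimMonotone_two (n : ℕ) :
    CampaignW46HypersurfacesEmbDimMonotone 2 n :=
  fun _ _ _ c i τ hM hM' => hypersurface_milnorEmbDim_step_le c i τ hM hM'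

/-- [OURS · L1 W4.6 rung (ii), every `n`; rev 2; NOT a statement of the manuscript]
`CampaignW46HypersurfacesEmbDimTwoDFour 2 n` holds (`hypersurface_milnorHilbertTwo_eq_one_iff`).
[cite: GreuelPfister2026, Thm 3.5 and Cor 3.7] -/
theorem campaignW46HypersurfacesEmbDimTwoDFour_two (n : ℕ) :
    CampaignW46HypersurfacesEmbDimTwoDFour 2 n :=
  fun _ _ _ c hM he => hypersurface_milnorHilbertTwo_eq_one_iff c hM he

/-- [OURS · L1 W4.6 rung (ii), every `n`; rev 2; NOT a statement of the manuscript]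
`CampaignW46HypersurfacesEmbDimTwoDropThree 2 n` holds (`hypersurface_mu_step_add_three_of_milnorHilbertTwo_eq_one`).
[folklore] -/
theorem campaignW46HypersurfacesEmbDimTwoDropThree_two (n : ℕ) :
    CampaignW46HypersurfacesEmbDimTwoDropThree 2 n :=
  fun _ _ _ c i τ hM he hh hM' => hypersurface_mu_step_add_three_of_milnorHilbertTwo_eq_one c i τ hM he hh hM'

/-- [OURS · L1 W4.6 rung (ii), every `n`; rev 3; NOT a statement of the manuscript]
`CampaignW46HypersurfacesEmbDimTwoExit 2 n` holds (`hypersurface_exit_classification`). [folklore] -/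
theorem campaignW46HypersurfacesEmbDimTwoExit_two (n : ℕ) :
    CampaignW46HypersurfacesEmbDimTwoExit 2 n :=
  fun _ _ _ c₀ i t hI he => hypersurface_exit_classification c₀ i t hI he

end Summit.ResolutionOfSingularities.ResolutionOfSingularities.Theorems

end
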